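import Mathlib
import HarnessLib

/-!
# Lenstra's algorithm in fixed dimension, I: polytopes are spanned by their basic points

Topic `Computability/Complexity`, grouping namespace `FixedDimILP`. First file of the proof that
integer linear programming over BOUNDED polyhedra is decidable in polynomial time for each fixed
number of variables (H. W. Lenstra 1983; Schrijver 1986, §18.4), the decider consumed by
`Literature.NumberTheory.DiophantineApproximation.SimultaneousApproxInstance.gsaLangOfDim_mem_P_of_decider`
(Lagarias 1985: GSA in fixed dimension is in `P`). For a fixed dimension the "rounding" step of the
algorithm is done by brute force over the vertices of the polytope, and this file supplies the
polyhedral facts that make the brute force complete. For a finite real system `sys` of rows `(a, β)`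
(read `a · x ≤ β`) in `ℝ^N`:

* `poly sys` — its solution set; closed and convex;
* `IsBasicPoint sys x` — `x` solves, with equality, `N` rows of `sys` whose coefficient vectors form a
  nonsingular matrix (a "basic solution");
* **`isBasicPoint_of_mem_extremePoints`** — every extreme point of `poly sys` is basic (if the tight
  rows do not span, a nonzero `y` orthogonal to them moves `x` inside `poly sys` in both directions);
* **`poly_subset_convexHull`** — a BOUNDED `poly sys` lies in the convex hull of any finite set
  containing its basic points (Krein–Milman, Mathlib `closure_convexHull_extremePoints`), and
  `exists_isBasicPoint` — a bounded non-empty `poly sys` has a basic point;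
* **`isBounded_poly_relax`** — if `poly sys` is bounded and NON-EMPTY then the relaxed system
  `a · x ≤ β + ε` is still bounded (a recession-direction argument by compactness of the sphere);
* `forall_int_le_iff_le_add_half` — for integral data, `a · x ≤ β ↔ a · x ≤ β + ½` on integer points:
  the relaxation by `½` does not change the integer points (but makes the polytope full-dimensional
  around each of them, file II).

## References

* A. Schrijver, *Theory of Linear and Integer Programming*, Wiley 1986, §8.3–8.5 (vertices of
  polyhedra are basic solutions; polytopes are convex hulls of their vertices), §18.4 (Lenstra's
  algorithm). [Schrijver1986]
* H. W. Lenstra, Jr., *Integer programming with a fixed number of variables*, Math. Oper. Res. 8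
  (1983) 538–548, §1–§2. [LenstraHW1983]
-/

namespace Literature.Computability.Complexity

namespace FixedDimILP

open Set Filter Topology

variable {N : ℕ}

/-! ### Real systems and their polyhedra -/

/-- A finite real system: rows `(a, β)` read `a · x ≤ β`. [cite: Schrijver1986, §7.2 (systems of linear inequalities)] -/
abbrev RealSys (N : ℕ) : Type := List ((Fin N → ℝ) × ℝ)

/-- The polyhedron `{x | a · x ≤ β for all rows}` of a real system. [cite: Schrijver1986, §7.2] -/
def poly (sys : RealSys N) : Set (Fin N → ℝ) := {x | ∀ r ∈ sys, r.1 ⬝ᵥ x ≤ r.2}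

/-- Membership in the polyhedron. [folklore] -/
theorem mem_poly {sys : RealSys N} {x : Fin N → ℝ} : x ∈ poly sys ↔ ∀ r ∈ sys, r.1 ⬝ᵥ x ≤ r.2 := Iff.rfl

/-- The polyhedron is convex. [cite: Schrijver1986, §7.2] -/
theorem convex_poly (sys : RealSys N) : Convex ℝ (poly sys) := by
  intro x hx y hy s t hs ht hst r hr
  have h1 := hx r hr
  have h2 := hy r hr
  rw [dotProduct_add, dotProduct_smul, dotProduct_smul, smul_eq_mul, smul_eq_mul]
  calc s * (r.1 ⬝ᵥ x) + t * (r.1 ⬝ᵥ y) ≤ s * r.2 + t * r.2 :=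
      add_le_add (mul_le_mul_of_nonneg_left h1 hs) (mul_le_mul_of_nonneg_left h2 ht)
    _ = r.2 := by rw [← add_mul, hst, one_mul]

/-- The polyhedron is closed. [folklore] -/
theorem isClosed_poly (sys : RealSys N) : IsClosed (poly sys) := by
  have : poly sys = ⋂ r ∈ sys, {x : Fin N → ℝ | r.1 ⬝ᵥ x ≤ r.2} := by ext x; simp [poly]
  rw [this]
  refine isClosed_biInter fun r _ => ?_
  exact isClosed_le (Continuous.dotProduct continuous_const continuous_id) continuous_const

/-! ### Basic points -/

/-- `x` is a BASIC point of the system: some `N` rows of `sys`, with nonsingular coefficient matrix,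
hold with equality at `x` (so `x` is the unique solution of that square subsystem).
[cite: Schrijver1986, §8.5 (vertices = basic feasible solutions)] -/
def IsBasicPoint (sys : RealSys N) (x : Fin N → ℝ) : Prop :=
  ∃ S : Fin N → (Fin N → ℝ) × ℝ, (∀ i, S i ∈ sys) ∧ (Matrix.of fun i => (S i).1).det ≠ 0 ∧
    ∀ i, (S i).1 ⬝ᵥ x = (S i).2

/-- A uniform margin for finitely many strict inequalities: if every row of `l` has positive slack
`s r`, some `ε > 0` has `ε |c r| < s r` for all rows. [folklore] -/
theorem exists_eps_mul_abs_lt {α : Type} (l : List α) (s c : α → ℝ) (hs : ∀ r ∈ l, 0 < s r) :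
    ∃ ε : ℝ, 0 < ε ∧ ∀ r ∈ l, ε * |c r| < s r := by
  induction l with
  | nil => exact ⟨1, one_pos, fun r hr => (List.not_mem_nil hr).elim⟩
  | cons r₀ l ih =>
    obtain ⟨ε, hε, hl⟩ := ih fun r hr => hs r (List.mem_cons_of_mem _ hr)
    have h0 := hs r₀ List.mem_cons_self
    refine ⟨min ε (s r₀ / (2 * (|c r₀| + 1))), lt_min hε (by positivity), fun r hr => ?_⟩
    rcases List.mem_cons.1 hr with rfl | hr
    · have hle : min ε (s r / (2 * (|c r| + 1))) * |c r| ≤ s r / (2 * (|c r| + 1)) * |c r| :=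
        mul_le_mul_of_nonneg_right (min_le_right _ _) (abs_nonneg _)
      have hlt : s r / (2 * (|c r| + 1)) * |c r| < s r := by
        rw [div_mul_eq_mul_div, div_lt_iff₀ (by positivity)]
        nlinarith [abs_nonneg (c r)]
      exact hle.trans_lt hlt
    · exact (mul_le_mul_of_nonneg_right (min_le_left _ _) (abs_nonneg _)).trans_lt (hl r hr)

/-- A linear functional on `ℝ^N` is the dot product with the vector of its values on the unit vectors.
[folklore] -/
theorem linearMap_apply_eq_dotProduct (f : (Fin N → ℝ) →ₗ[ℝ] ℝ) (x : Fin N → ℝ) :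
    f x = (fun j => f (Pi.single j 1)) ⬝ᵥ x := by
  rw [LinearMap.pi_apply_eq_sum_univ f x, dotProduct]
  refine Finset.sum_congr rfl fun j _ => ?_
  have hj : (fun k => if j = k then (1 : ℝ) else 0) = Pi.single j 1 := by
    funext k; simp [Pi.single_apply, eq_comm]
  rw [smul_eq_mul, mul_comm, hj]

/-- If the tight rows at a point of the polyhedron do not span `ℝ^N`, the point is the midpoint of two
other points of the polyhedron. [cite: Schrijver1986, §8.3–8.5 (proof that minimal faces are affine)] -/
theorem exists_add_sub_mem_poly {sys : RealSys N} {x : Fin N → ℝ} (hx : x ∈ poly sys)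
    (hspan : Submodule.span ℝ {a | ∃ r ∈ sys, r.1 = a ∧ r.1 ⬝ᵥ x = r.2} < ⊤) :
    ∃ y : Fin N → ℝ, y ≠ 0 ∧ x + y ∈ poly sys ∧ x - y ∈ poly sys := by
  obtain ⟨f, hf0, hker⟩ := Submodule.exists_le_ker_of_lt_top _ hspan
  set c : Fin N → ℝ := fun j => f (Pi.single j 1) with hc
  have hfc : ∀ z, f z = c ⬝ᵥ z := linearMap_apply_eq_dotProduct f
  have hc0 : c ≠ 0 := by
    intro h
    apply hf0
    apply LinearMap.ext
    intro z
    rw [hfc, h, zero_dotProduct, LinearMap.zero_apply]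
  -- tight rows are orthogonal to `c`
  have htight : ∀ r ∈ sys, r.1 ⬝ᵥ x = r.2 → r.1 ⬝ᵥ c = 0 := by
    intro r hr he
    have hmem : r.1 ∈ Submodule.span ℝ {a | ∃ r ∈ sys, r.1 = a ∧ r.1 ⬝ᵥ x = r.2} :=
      Submodule.subset_span ⟨r, hr, rfl, he⟩
    have := hker hmem
    rw [LinearMap.mem_ker, hfc, dotProduct_comm] at this
    exact this
  -- slack rows give a margin
  obtain ⟨ε, hε, hmargin⟩ := exists_eps_mul_abs_lt (sys.filter fun r => decide (r.1 ⬝ᵥ x < r.2))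
    (fun r => r.2 - r.1 ⬝ᵥ x) (fun r => r.1 ⬝ᵥ c) (fun r hr => by
      have := (List.mem_filter.1 hr).2
      rw [decide_eq_true_eq] at this
      linarith)
  refine ⟨ε • c, smul_ne_zero hε.ne' hc0, fun r hr => ?_, fun r hr => ?_⟩
  · rw [dotProduct_add, dotProduct_smul, smul_eq_mul]
    rcases (hx r hr).lt_or_eq with hlt | heq
    · have hm := hmargin r (List.mem_filter.2 ⟨hr, by rw [decide_eq_true_eq]; exact hlt⟩)
      have := le_abs_self (r.1 ⬝ᵥ c)
      nlinarith
    · rw [htight r hr heq, mul_zero, add_zero]; exact heq.le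
  · rw [dotProduct_sub, dotProduct_smul, smul_eq_mul]
    rcases (hx r hr).lt_or_eq with hlt | heq
    · have hm := hmargin r (List.mem_filter.2 ⟨hr, by rw [decide_eq_true_eq]; exact hlt⟩)
      have := neg_abs_le (r.1 ⬝ᵥ c)
      nlinarith
    · rw [htight r hr heq, mul_zero, sub_zero]; exact heq.le

/-- **Extreme points of a polyhedron are basic** (Schrijver 1986, Thm. 8.4 / §8.5: a vertex of
`{x | Ax ≤ b}` is determined by `N` linearly independent tight rows). [cite: Schrijver1986, Thm. 8.4 and §8.5] -/
theorem isBasicPoint_of_mem_extremePoints {sys : RealSys N} {x : Fin N → ℝ}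
    (hx : x ∈ (poly sys).extremePoints ℝ) : IsBasicPoint sys x := by
  classical
  obtain ⟨hxP, hext⟩ := hx
  set T : Set (Fin N → ℝ) := {a | ∃ r ∈ sys, r.1 = a ∧ r.1 ⬝ᵥ x = r.2} with hT
  -- the tight rows span everything
  have hspan : Submodule.span ℝ T = ⊤ := by
    by_contra h
    obtain ⟨y, hy0, h1, h2⟩ := exists_add_sub_mem_poly hxP (lt_top_iff_ne_top.2 h)
    have hseg : x ∈ openSegment ℝ (x + y) (x - y) := by
      refine ⟨1 / 2, 1 / 2, by norm_num, by norm_num, by norm_num, ?_⟩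
      ext j
      simp only [Pi.add_apply, Pi.smul_apply, Pi.sub_apply, smul_eq_mul]
      ring
    have hxy : x + y = x := hext h1 h2 hseg
    exact hy0 (by simpa using hxy)
  -- extract `N` linearly independent tight vectors
  obtain ⟨b, hbT, hbspan, hbli⟩ := exists_linearIndependent ℝ T
  have hbspan' : Submodule.span ℝ b = ⊤ := by rw [hbspan, hspan]
  haveI : Fintype b := (LinearIndependent.setFinite hbli).fintype
  let B : Module.Basis b ℝ (Fin N → ℝ) := Module.Basis.mk hbli (by rw [Subtype.range_coe, hbspan'])
  have hcard : Fintype.card b = N := by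
    have h := Module.finrank_eq_card_basis B
    rw [Module.finrank_fin_fun] at h
    exact h.symm
  let e : Fin N ≃ b := (Fintype.equivFinOfCardEq hcard).symm
  -- each chosen vector comes from a tight row
  have hrow : ∀ i : Fin N, ∃ r ∈ sys, r.1 = (e i : Fin N → ℝ) ∧ r.1 ⬝ᵥ x = r.2 := fun i => hbT (e i).2
  choose S hS using hrow
  refine ⟨S, fun i => (hS i).1, ?_, fun i => (hS i).2.2⟩
  have hli : LinearIndependent ℝ (fun i => (S i).1) := by
    have : (fun i => (S i).1) = (fun v : b => (v : Fin N → ℝ)) ∘ e := funext fun i => (hS i).2.1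
    rw [this]
    exact hbli.comp _ e.injective
  have hunit : IsUnit (Matrix.of fun i => (S i).1) := Matrix.linearIndependent_rows_iff_isUnit.1 hli
  exact ((Matrix.isUnit_iff_isUnit_det _).1 hunit).ne_zero

/-! ### Bounded polyhedra are spanned by their basic points -/

/-- **A polytope lies in the convex hull of its basic points**: if `poly sys` is bounded and the finite
set `V` contains every basic point of `poly sys` that lies in `poly sys`, then `poly sys ⊆ conv V`
(Krein–Milman: a compact convex set is the closed convex hull of its extreme points, which are basic).
[cite: Schrijver1986, §8.4–8.5 (polytope = convex hull of its vertices)] -/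
theorem poly_subset_convexHull {sys : RealSys N} (hb : Bornology.IsBounded (poly sys)) {V : Set (Fin N → ℝ)}
    (hVfin : V.Finite) (hV : ∀ x ∈ poly sys, IsBasicPoint sys x → x ∈ V) :
    poly sys ⊆ convexHull ℝ V := by
  have hcomp : IsCompact (poly sys) := Metric.isCompact_of_isClosed_isBounded (isClosed_poly sys) hb
  have hKM := closure_convexHull_extremePoints hcomp (convex_poly sys)
  have hsub : (poly sys).extremePoints ℝ ⊆ V := fun x hx =>
    hV x hx.1 (isBasicPoint_of_mem_extremePoints hx)
  calc poly sys = closure (convexHull ℝ ((poly sys).extremePoints ℝ)) := hKM.symm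
    _ ⊆ closure (convexHull ℝ V) := closure_mono (convexHull_mono hsub)
    _ = convexHull ℝ V := ((hVfin.isCompact_convexHull (𝕜 := ℝ)).isClosed).closure_eq

/-- A bounded non-empty polyhedron has a basic point in it (an extreme point exists by compactness).
[cite: Schrijver1986, §8.5] -/
theorem exists_isBasicPoint {sys : RealSys N} (hb : Bornology.IsBounded (poly sys)) (hne : (poly sys).Nonempty) :
    ∃ x ∈ poly sys, IsBasicPoint sys x := by
  have hcomp : IsCompact (poly sys) := Metric.isCompact_of_isClosed_isBounded (isClosed_poly sys) hb
  obtain ⟨x, hx⟩ := hcomp.extremePoints_nonempty hne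
  exact ⟨x, hx.1, isBasicPoint_of_mem_extremePoints hx⟩

/-- A linear functional valid on a finite set is valid on its convex hull: if `c · v ≥ μ` on `V` then
`c · x ≥ μ` on `conv V`. [folklore] -/
theorem le_dotProduct_of_mem_convexHull {V : Set (Fin N → ℝ)} {c : Fin N → ℝ} {μ : ℝ}
    (hV : ∀ v ∈ V, μ ≤ c ⬝ᵥ v) {x : Fin N → ℝ} (hx : x ∈ convexHull ℝ V) : μ ≤ c ⬝ᵥ x := by
  have hconv : Convex ℝ {y : Fin N → ℝ | μ ≤ c ⬝ᵥ y} := by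
    intro y hy z hz s t hs ht hst
    simp only [Set.mem_setOf_eq, dotProduct_add, dotProduct_smul, smul_eq_mul] at hy hz ⊢
    calc μ = s * μ + t * μ := by rw [← add_mul, hst, one_mul]
      _ ≤ s * (c ⬝ᵥ y) + t * (c ⬝ᵥ z) := add_le_add (mul_le_mul_of_nonneg_left hy hs) (mul_le_mul_of_nonneg_left hz ht)
  exact (convexHull_min (fun v hv => hV v hv) hconv) hx

/-- Rows valid on a finite set are valid on its convex hull: `conv V ⊆ poly sys` when `V ⊆ poly sys`.
[folklore] -/
theorem convexHull_subset_poly {sys : RealSys N} {V : Set (Fin N → ℝ)} (hV : V ⊆ poly sys) :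
    convexHull ℝ V ⊆ poly sys :=
  convexHull_min hV (convex_poly sys)

/-! ### Relaxing the right-hand sides keeps a non-empty polytope bounded -/

/-- The relaxed system `a · x ≤ β + ε`. [cite: LenstraHW1983, §1 (the transformed problem)] -/
def relax (sys : RealSys N) (ε : ℝ) : RealSys N := sys.map fun r => (r.1, r.2 + ε)

/-- Membership in the relaxed polyhedron. [folklore] -/
theorem mem_poly_relax {sys : RealSys N} {ε : ℝ} {x : Fin N → ℝ} :
    x ∈ poly (relax sys ε) ↔ ∀ r ∈ sys, r.1 ⬝ᵥ x ≤ r.2 + ε := by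
  rw [mem_poly, relax, List.forall_mem_map]

/-- The polyhedron lies in its relaxations (`ε ≥ 0`). [folklore] -/
theorem poly_subset_poly_relax (sys : RealSys N) {ε : ℝ} (hε : 0 ≤ ε) : poly sys ⊆ poly (relax sys ε) :=
  fun _ hx => mem_poly_relax.2 fun r hr => (hx r hr).trans (le_add_of_nonneg_right hε)

/-- **A bounded non-empty polyhedron stays bounded under relaxation of the right-hand sides.**
If `poly (relax sys ε)` were unbounded, normalised directions from a point `x₀ ∈ poly sys` to far
points accumulate (compact sphere) at a direction `u` with `a · u ≤ 0` for every row, and then the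
whole ray `x₀ + t u` lies in `poly sys`. [cite: Schrijver1986, §8.2 (characteristic cone; a polyhedron is bounded iff its characteristic cone is `{0}`)] -/
theorem isBounded_poly_relax {sys : RealSys N} (hb : Bornology.IsBounded (poly sys)) (hne : (poly sys).Nonempty)
    (ε : ℝ) : Bornology.IsBounded (poly (relax sys ε)) := by
  obtain ⟨x₀, hx₀⟩ := hne
  by_contra hunb
  -- far points of the relaxed polyhedron
  have hfar : ∀ k : ℕ, ∃ x ∈ poly (relax sys ε), (k : ℝ) + 1 ≤ ‖x - x₀‖ := by
    intro k
    by_contra! h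
    apply hunb
    refine (Metric.isBounded_closedBall (x := x₀) (r := (k : ℝ) + 1)).subset fun x hx => ?_
    rw [Metric.mem_closedBall, dist_eq_norm]
    exact (h x hx).le
  choose xs hxs hfarxs using hfar
  have hpos : ∀ k, 0 < ‖xs k - x₀‖ := fun k => lt_of_lt_of_le (by positivity) (hfarxs k)
  -- normalised directions accumulate on the unit sphere
  set u : ℕ → (Fin N → ℝ) := fun k => ‖xs k - x₀‖⁻¹ • (xs k - x₀) with hu
  have hus : ∀ k, u k ∈ Metric.sphere (0 : Fin N → ℝ) 1 := fun k => by
    rw [mem_sphere_zero_iff_norm, hu, norm_smul, norm_inv, norm_norm, inv_mul_cancel₀ (hpos k).ne']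
  obtain ⟨d, hd, φ, hφ, hlim⟩ := (isCompact_sphere (0 : Fin N → ℝ) 1).tendsto_subseq hus
  rw [mem_sphere_zero_iff_norm] at hd
  -- every row is non-positive on the limit direction
  have hrow : ∀ r ∈ sys, r.1 ⬝ᵥ d ≤ 0 := by
    intro r hr
    have hcont : Tendsto (fun k => r.1 ⬝ᵥ u (φ k)) atTop (𝓝 (r.1 ⬝ᵥ d)) :=
      ((Continuous.dotProduct continuous_const continuous_id).tendsto d).comp hlim
    -- `a · u_k ≤ (β + ε - a · x₀) / ‖x_k - x₀‖ ≤ |β + ε - a · x₀| / (k + 1)`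
    have hbound : ∀ k, r.1 ⬝ᵥ u (φ k) ≤ |r.2 + ε - r.1 ⬝ᵥ x₀| / ((φ k : ℝ) + 1) := by
      intro k
      have h1 : r.1 ⬝ᵥ u (φ k) = ‖xs (φ k) - x₀‖⁻¹ * (r.1 ⬝ᵥ xs (φ k) - r.1 ⬝ᵥ x₀) := by
        rw [hu]; simp only [dotProduct_smul, smul_eq_mul, dotProduct_sub]
      have h2 : r.1 ⬝ᵥ xs (φ k) - r.1 ⬝ᵥ x₀ ≤ |r.2 + ε - r.1 ⬝ᵥ x₀| := by
        have := mem_poly_relax.1 (hxs (φ k)) r hr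
        exact le_trans (by linarith) (le_abs_self _)
      rw [h1, inv_mul_eq_div, div_le_div_iff₀ (hpos _) (by positivity)]
      calc (r.1 ⬝ᵥ xs (φ k) - r.1 ⬝ᵥ x₀) * ((φ k : ℝ) + 1)
          ≤ |r.2 + ε - r.1 ⬝ᵥ x₀| * ((φ k : ℝ) + 1) := mul_le_mul_of_nonneg_right h2 (by positivity)
        _ ≤ |r.2 + ε - r.1 ⬝ᵥ x₀| * ‖xs (φ k) - x₀‖ := mul_le_mul_of_nonneg_left (hfarxs _) (abs_nonneg _)
    have hzero : Tendsto (fun k => |r.2 + ε - r.1 ⬝ᵥ x₀| / ((φ k : ℝ) + 1)) atTop (𝓝 0) := by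
      have hφ' : Tendsto (fun k => (φ k : ℝ) + 1) atTop atTop := by
        have := (tendsto_natCast_atTop_atTop (R := ℝ)).comp hφ.tendsto_atTop
        exact tendsto_atTop_add_const_right _ 1 this
      exact tendsto_const_nhds.div_atTop hφ'
    exact le_of_tendsto_of_tendsto' hcont hzero hbound
  -- hence the whole ray from `x₀` in direction `d` lies in `poly sys`, contradicting boundedness
  have hray : ∀ t : ℝ, 0 ≤ t → x₀ + t • d ∈ poly sys := by
    intro t ht r hr
    rw [dotProduct_add, dotProduct_smul, smul_eq_mul]
    have := hx₀ r hr
    nlinarith [hrow r hr]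
  obtain ⟨R, hR⟩ := (Metric.isBounded_iff_subset_closedBall x₀).1 hb
  have hmem := hR (hray (|R| + 1) (by positivity))
  rw [Metric.mem_closedBall, dist_eq_norm, add_sub_cancel_left, norm_smul, hd, mul_one,
    Real.norm_eq_abs, abs_of_nonneg (by positivity)] at hmem
  linarith [le_abs_self R]

/-! ### Integral data: relaxing by one half does not change the integer points -/

/-- For integers, `m ≤ β ↔ m ≤ β + ½` (in `ℝ`). [folklore] -/
theorem int_le_iff_le_add_half (m β : ℤ) : m ≤ β ↔ (m : ℝ) ≤ β + 1 / 2 := by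
  constructor
  · intro h
    exact (show (m : ℝ) ≤ β by exact_mod_cast h).trans (le_add_of_nonneg_right (by norm_num))
  · intro h
    by_contra! h'
    have : (β : ℝ) + 1 ≤ m := by exact_mod_cast h'
    linarith

/-- Doubling an integral row and adding one to the right-hand side is the relaxation by `½`:
`2a · x ≤ 2β + 1 ↔ a · x ≤ β + ½`. [folklore] -/
theorem two_mul_dotProduct_le_iff (a x : Fin N → ℝ) (β : ℝ) :
    ((2 : ℝ) • a) ⬝ᵥ x ≤ 2 * β + 1 ↔ a ⬝ᵥ x ≤ β + 1 / 2 := by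
  rw [smul_dotProduct, smul_eq_mul]
  constructor <;> intro h <;> linarith

end FixedDimILP

end Literature.Computability.Complexity
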